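import Mathlib.Analysis.SpecialFunctions.Exponential
import Mathlib.Analysis.Calculus.MeanValue
import Mathlib.Analysis.Calculus.Deriv.Mul
import Mathlib.Analysis.Normed.Algebra.MatrixExponential
import Mathlib.Analysis.Matrix.Normed
import Mathlib.Topology.Algebra.Module.FiniteDimension
import Literature.MathematicalPhysics.QuantumLattice.FermionOperatorsProofs
import Literature.MathematicalPhysics.QuantumLattice.FinDimSpectrum
import Literature.MathematicalPhysics.QuantumLattice.HubbardModel
import HarnessLib

/-!
# Quasi-free Gibbs states of lattice fermions, I: imaginary-time evolution of the fields and
the thermal two-point function (the Fermi matrix)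

Topic `MathematicalPhysics/QuantumLattice`. For a finite, linearly ordered orbital set `ι` the
tree models the fermionic Fock space as `ℓ²(Finset ι)` with Jordan–Wigner matrices
`creation i`, `annihilation i` (`HubbardWave0`, CAR proved in `FermionOperatorsProofs`) and
finite-volume Gibbs states `gibbsWeight β H = e^{-βH}`, `thermalCorr β H A B = tr(e^{-βH}AB)/Z`
(`FinDimSpectrum`). This file adds the **free (quasi-free) layer** that every weak-coupling
expansion of an interacting lattice fermion system starts from — in particular the
renormalisation-group construction of Benfatto–Giuliani–Mastropietro (Ann. Henri Poincaré 7
(2006) 809, the tree's named fact `bgm_two_point_limit` of `HubbardFermiLiquid.lean`), whose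
§1.2 and §2.1 take as input the imaginary-time evolved fields `a^±_𝐱 = e^{H₀x₀} a^±_{x⃗} e^{-H₀x₀}`
(eq. (1.2)), the free propagator (1.4) and the "Wick rule" at `U = 0`. Everything is PROVED:

* `exp_mul_mul_exp_neg_eq_sum_of_commutator` — in a complete normed algebra, if
  `[X, Y_l] = Σ_k A_{kl} Y_k` on a finite family then `e^X Y_j e^{-X} = Σ_k (e^A)_{kj} Y_k`
  (`Ad e^X = e^{ad X}` on an `ad X`-invariant finite-dimensional subspace; proof:
  `u ↦ e^{-uX}(Σ_k (e^{uA})_{kj} Y_k)e^{uX}` has zero derivative);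
* `dGamma h = Σ_{ij} h_{ij} c†_i c_j`, the second quantisation of a one-body matrix, with
  `dGamma_commutator_creation/annihilation` (`[dΓ(h), c†_j] = Σ_k h_{kj} c†_k`,
  `[dΓ(h), c_j] = -Σ_k h_{jk} c_k`) and `isHermitian_dGamma`;
* `exp_dGamma_mul_creation_mul_exp_neg`, `exp_dGamma_mul_annihilation_mul_exp_neg` — the
  imaginary-time evolution `e^{s dΓ(h)} c†_j e^{-s dΓ(h)} = Σ_k (e^{sh})_{kj} c†_k`,
  `e^{s dΓ(h)} c_j e^{-s dΓ(h)} = Σ_k (e^{-sh})_{jk} c_k` for all `s ∈ ℂ`;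
* `creation_mul_gibbsWeight_dGamma`, `annihilation_mul_gibbsWeight_dGamma` — Gaudin's
  pull-through formulas `c†_i e^{-βdΓ(h)} = Σ_k (e^{βh})_{ki} e^{-βdΓ(h)} c†_k` etc.;
* `trace_gibbsWeight_dGamma_two_point_add`, `transpose_one_add_exp_mul_twoPointTraceMatrix` —
  Gaudin's identity `(1 + e^{βh})ᵀ F = Z · 1` for `F_{ij} = tr(e^{-βdΓ(h)} c†_i c_j)` (CAR +
  cyclicity of the trace + pull-through), valid for every complex `h`;
* `thermalCorr_dGamma_creation_annihilation` — for Hermitian `h` and real `β` the thermal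
  two-point function of the quasi-free Gibbs state is the Fermi matrix,
  `⟨c†_i c_j⟩_β = [(1 + e^{βh})⁻¹]_{ji}` (`1 + e^{βh}` is positive definite,
  `posDef_one_add_exp_smul`), and `⟨c_j c†_i⟩_β = δ_{ij} - [(1 + e^{βh})⁻¹]_{ji}`;
* `hamiltonianWith_zero_eq_dGamma`, `thermalCorr_hamiltonianWith_zero` — the grand-canonical
  Hubbard Hamiltonian at `U = 0` on any finite graph is `dΓ(hubbardOneBody G t μ)`,
  `h = -t (adjacency ⊗ 1_spin) - μ`, so its thermal two-point function is the Fermi matrix of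
  `h` (BGM's free propagator (1.4) at equal times, in position space and finite volume).

Not here (next steps of the same programme): the thermal Wick theorem for higher monomials
(Gaudin's recursion iterated), the plane-wave diagonalisation of `hubbardOneBody` on the torus
and the `L → ∞` limit of the free two-point function.

## Mathlib / tree search

Mathlib: `NormedSpace.exp`, `hasDerivAt_exp_smul_const(')`, `is_const_of_deriv_eq_zero`,
`Matrix.exp_transpose`, `Matrix.exp_add_of_commute`, the scoped matrix operator norm
`Matrix.Norms.Operator`, `Matrix.PosDef`; no second quantisation / quasi-free states
(`lean search 'quasiFree|dGamma|secondQuant'`: nothing relevant). Tree: CAR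
(`annihilation_mul_creation_add_creation_mul_annihilation_holds`, `annihilation_anticommute_holds`,
`creation_mul_creation_eq_neg`), Gibbs states (`gibbsWeight`, `posDef_gibbsWeight`,
`partitionFn_pos`), `hamiltonianWith` (`HubbardModel`), `totalNumberOp_eq_totalNumber`.

## References

* G. Benfatto, A. Giuliani, V. Mastropietro, *Fermi liquid behavior in the 2D Hubbard model at
  low temperatures*, Ann. Henri Poincaré 7 (2006) 809–898, §1.2 (eqs. (1.1), (1.2), (1.4)) and
  §2.1. [BenfattoGiulianiMastropietro2006]
* O. Bratteli, D. W. Robinson, *Operator Algebras and Quantum Statistical Mechanics 2*, 2nd ed.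
  (Springer 1997), §5.2.1 (CAR algebra, second quantisation), §5.2.4 (the ideal Fermi gas:
  Gibbs/KMS state = gauge-invariant quasi-free state with one-particle density `(1+e^{βh})⁻¹`).
  [BratteliRobinsonII1997]
* M. Gaudin, *Une démonstration simplifiée du théorème de Wick en mécanique statistique*,
  Nucl. Phys. 15 (1960) 89–91 (the trace-cyclicity / pull-through proof). [Gaudin1960]
-/

noncomputable section

open NormedSpace Matrix Finset
open scoped Topology ComplexOrder

namespace Literature.MathematicalPhysics.QuantumLattice

/-! ### Conjugation by an exponential along a finite-dimensional `ad`-invariant family -/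

section Conjugation

variable {𝕂 𝔸 κ : Type*} [RCLike 𝕂] [NormedRing 𝔸] [NormedAlgebra 𝕂 𝔸] [CompleteSpace 𝔸]
  [Fintype κ] [DecidableEq κ]

section EntryDeriv

open scoped Matrix.Norms.Operator

/-- Evaluation of a matrix entry, as a continuous linear map. [folklore] -/
private def entryCLM (k j : κ) : Matrix κ κ 𝕂 →L[𝕂] 𝕂 :=
  LinearMap.toContinuousLinearMap
    { toFun := fun M => M k j
      map_add' := fun _ _ => rfl
      map_smul' := fun _ _ => rfl }

/-- The entries of `u ↦ e^{uA}` are differentiable with derivative the entries of `A e^{uA}`.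
[folklore] -/
private theorem hasDerivAt_exp_smul_apply (A : Matrix κ κ 𝕂) (k j : κ) (u : 𝕂) :
    HasDerivAt (fun v : 𝕂 => (exp (v • A)) k j) (∑ l, A k l * (exp (u • A)) l j) u := by
  have h := (entryCLM (𝕂 := 𝕂) k j).hasFDerivAt.comp_hasDerivAt u
    (hasDerivAt_exp_smul_const' (𝕂 := 𝕂) A u)
  rw [← Matrix.mul_apply]
  exact h

end EntryDeriv

/-- **Conjugation by `e^X` along an `ad X`-invariant finite family.** If
`[X, Y_l] = Σ_k A_{kl} Y_k` for all `l`, then `e^{X} Y_j e^{-X} = Σ_k (e^{A})_{kj} Y_k`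
(`Ψ(u) = e^{-uX} (Σ_k (e^{uA})_{kj} Y_k) e^{uX}` has `Ψ' = 0`). This is the finite-dimensional
form of `Ad(e^X) = e^{ad X}` used for the imaginary-time evolution of fermion fields under a
quadratic Hamiltonian (Benfatto–Giuliani–Mastropietro 2006, §1.2, `a^±_𝐱 = e^{H x₀} a^± e^{-H x₀}`).
[folklore] -/
theorem exp_mul_mul_exp_neg_eq_sum_of_commutator (X : 𝔸) (Y : κ → 𝔸) (A : Matrix κ κ 𝕂)
    (hXY : ∀ l, X * Y l - Y l * X = ∑ k, A k l • Y k) (j : κ) :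
    exp X * Y j * exp (-X) = ∑ k, (exp A) k j • Y k := by
  -- coefficient functions `c k u = (e^{uA})_{kj}` and the family `Z u = Σ_k c k u • Y k`
  set c : κ → 𝕂 → 𝕂 := fun k u => (exp (u • A)) k j with hc
  have hcd : ∀ k u, HasDerivAt (c k) (∑ l, A k l * c l u) u := fun k u =>
    hasDerivAt_exp_smul_apply A k j u
  set Z : 𝕂 → 𝔸 := fun u => ∑ k, c k u • Y k with hZ
  have hZd : ∀ u, HasDerivAt Z (X * Z u - Z u * X) u := by
    intro u
    have h : HasDerivAt Z (∑ k, (∑ l, A k l * c l u) • Y k) u :=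
      HasDerivAt.fun_sum fun k _ => (hcd k u).smul_const (Y k)
    convert h using 1
    calc X * Z u - Z u * X = ∑ l, c l u • (X * Y l - Y l * X) := by
          simp only [hZ, Finset.mul_sum, Finset.sum_mul, mul_smul_comm, smul_mul_assoc, smul_sub,
            Finset.sum_sub_distrib]
      _ = ∑ l, ∑ k, (A k l * c l u) • Y k := by
          refine Finset.sum_congr rfl fun l _ => ?_
          rw [hXY l, Finset.smul_sum]
          refine Finset.sum_congr rfl fun k _ => ?_
          rw [smul_smul, mul_comm]
      _ = ∑ k, (∑ l, A k l * c l u) • Y k := by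
          rw [Finset.sum_comm]
          refine Finset.sum_congr rfl fun k _ => ?_
          rw [Finset.sum_smul]
  -- `Ψ u = e^{-uX} Z(u) e^{uX}` is constant
  set Ψ : 𝕂 → 𝔸 := fun u => exp (u • -X) * Z u * exp (u • X) with hΨ
  have hΨd : ∀ u, HasDerivAt Ψ 0 u := by
    intro u
    have h1 := hasDerivAt_exp_smul_const' (𝕂 := 𝕂) (-X) u
    have h2 := hasDerivAt_exp_smul_const (𝕂 := 𝕂) X u
    have hc1 : -X * exp (u • -X) = exp (u • -X) * -X :=
      (((Commute.refl (-X)).smul_left u).exp_left).eq.symm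
    have hc2 : exp (u • X) * X = X * exp (u • X) :=
      (((Commute.refl X).smul_left u).exp_left).eq
    have key : (-X * exp (u • -X) * Z u + exp (u • -X) * (X * Z u - Z u * X)) * exp (u • X) +
        exp (u • -X) * Z u * (exp (u • X) * X) = 0 := by
      rw [hc1, hc2]; noncomm_ring
    have h := (h1.fun_mul (hZd u)).fun_mul h2
    rw [key] at h
    exact h
  have hconst : Ψ 1 = Ψ 0 :=
    is_const_of_deriv_eq_zero (fun u => (hΨd u).differentiableAt) (fun u => (hΨd u).deriv) 1 0
  have hZ0 : Z 0 = Y j := by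
    simp only [hZ, hc, zero_smul, exp_zero, Matrix.one_apply, ite_smul, one_smul, zero_smul,
      Finset.sum_ite_eq', Finset.mem_univ, if_true]
  have hΨ0 : Ψ 0 = Y j := by
    simp only [hΨ, zero_smul, exp_zero, one_mul, mul_one, hZ0]
  have hΨ1 : Ψ 1 = exp (-X) * Z 1 * exp X := by
    simp only [hΨ, one_smul]
  have hZ1 : Z 1 = ∑ k, (exp A) k j • Y k := by
    simp only [hZ, hc, one_smul]
  have hee : exp X * exp (-X) = 1 := by
    have h := NormedSpace.exp_add_of_commute_of_mem_ball (Commute.refl X).neg_right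
      ((expSeries_radius_eq_top 𝕂 𝔸).symm ▸ edist_lt_top _ _)
      ((expSeries_radius_eq_top 𝕂 𝔸).symm ▸ edist_lt_top _ _)
    rwa [add_neg_cancel, exp_zero, eq_comm] at h
  calc exp X * Y j * exp (-X) = exp X * (exp (-X) * Z 1 * exp X) * exp (-X) := by
        rw [← hΨ1, hconst, hΨ0]
    _ = exp X * exp (-X) * Z 1 * (exp X * exp (-X)) := by noncomm_ring
    _ = ∑ k, (exp A) k j • Y k := by rw [hee, one_mul, mul_one, hZ1]

end Conjugation

/-! ### Second quantisation `dΓ(h)` of a one-body matrix and its commutators with the fields -/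

section Fock

variable {ι : Type*} [LinearOrder ι] [Fintype ι]

/-- The second quantisation `dΓ(h) = Σ_{i,j} h_{ij} c†_i c_j` of a one-body matrix `h` on the
finite fermionic Fock space (the general particle-number conserving quadratic Hamiltonian; for
the Hubbard model at `U = 0`, `h = -t·(adjacency ⊗ 1_spin) - μ`).
Bratteli–Robinson II §5.2.1 (second quantisation); BGM 2006, eq. (1.1) at `U = 0` (`H₀`, §2.1).
[cite: BratteliRobinsonII1997, §5.2.1] -/
def dGamma (h : Matrix ι ι ℂ) : Matrix (Finset ι) (Finset ι) ℂ :=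
  ∑ i, ∑ j, h i j • (creation i * annihilation j)

/-- `dGamma` unfolded. [folklore] -/
theorem dGamma_eq (h : Matrix ι ι ℂ) :
    dGamma h = ∑ i, ∑ j, h i j • (creation i * annihilation j) := rfl

/-- `dΓ` is additive. Bratteli–Robinson II §5.2.1. [folklore] -/
theorem dGamma_add (h h' : Matrix ι ι ℂ) : dGamma (h + h') = dGamma h + dGamma h' := by
  simp only [dGamma, Matrix.add_apply, add_smul, Finset.sum_add_distrib]

/-- `dΓ` is homogeneous. Bratteli–Robinson II §5.2.1. [folklore] -/
theorem dGamma_smul (a : ℂ) (h : Matrix ι ι ℂ) : dGamma (a • h) = a • dGamma h := by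
  simp only [dGamma, Matrix.smul_apply, smul_eq_mul, Finset.smul_sum, smul_smul]

/-- `dΓ` of a diagonal matrix is a weighted number operator, `dΓ(diag ε) = Σ_i ε_i n_i`.
Bratteli–Robinson II §5.2.1. [folklore] -/
theorem dGamma_diagonal (ε : ι → ℂ) : dGamma (diagonal ε) = ∑ i, ε i • numberAt i := by
  simp only [dGamma, diagonal_apply, ite_smul, zero_smul, Finset.sum_ite_eq, Finset.mem_univ,
    if_true, numberAt]

/-- `dΓ(h)ᴴ = dΓ(hᴴ)`. Bratteli–Robinson II §5.2.1. [folklore] -/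
theorem dGamma_conjTranspose (h : Matrix ι ι ℂ) : (dGamma h)ᴴ = dGamma hᴴ := by
  simp only [dGamma, conjTranspose_sum, conjTranspose_smul, conjTranspose_mul,
    creation_conjTranspose, annihilation_conjTranspose, conjTranspose_apply]
  rw [Finset.sum_comm]

/-- `dΓ(h)` is Hermitian for Hermitian `h`. Bratteli–Robinson II §5.2.1. [folklore] -/
theorem isHermitian_dGamma {h : Matrix ι ι ℂ} (hh : h.IsHermitian) : (dGamma h).IsHermitian := by
  rw [IsHermitian, dGamma_conjTranspose, hh.eq]

/-- `[c†_i c_l, c†_j] = δ_{lj} c†_i`. Bratteli–Robinson II §5.2.1 (CAR). [folklore] -/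
theorem creation_mul_annihilation_commutator_creation (i l j : ι) :
    creation i * annihilation l * creation j - creation j * (creation i * annihilation l) =
      if l = j then creation i else 0 := by
  rw [mul_assoc, annihilation_mul_creation, mul_sub, ← mul_assoc, ← mul_assoc,
    creation_mul_creation_eq_neg j i, mul_ite, mul_one, mul_zero]
  noncomm_ring

/-- `[c†_i c_l, c_j] = -δ_{ij} c_l`. Bratteli–Robinson II §5.2.1 (CAR). [folklore] -/
theorem creation_mul_annihilation_commutator_annihilation (i l j : ι) :
    creation i * annihilation l * annihilation j - annihilation j * (creation i * annihilation l) =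
      if i = j then -annihilation l else 0 := by
  have hll : annihilation l * annihilation j = -(annihilation j * annihilation l) :=
    eq_neg_of_add_eq_zero_left (annihilation_anticommute_holds l j)
  rw [mul_assoc, hll, ← mul_assoc, annihilation_mul_creation, sub_mul, ite_mul, one_mul, zero_mul]
  by_cases h : i = j
  · subst h; simp only [if_true]; noncomm_ring
  · rw [if_neg h, if_neg (Ne.symm h)]; noncomm_ring

/-- **`[dΓ(h), c†_j] = Σ_k h_{kj} c†_k`**: the creation operators span an `ad dΓ(h)`-invariant
space on which `ad dΓ(h)` acts by the matrix `h`. Bratteli–Robinson II §5.2.1. [folklore] -/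
theorem dGamma_commutator_creation (h : Matrix ι ι ℂ) (j : ι) :
    dGamma h * creation j - creation j * dGamma h = ∑ k, h k j • creation k := by
  simp only [dGamma, Finset.sum_mul, Finset.mul_sum, Matrix.smul_mul, Matrix.mul_smul,
    ← Finset.sum_sub_distrib, ← smul_sub, creation_mul_annihilation_commutator_creation, smul_ite,
    smul_zero, Finset.sum_ite_eq', Finset.mem_univ, if_true]

/-- **`[dΓ(h), c_j] = -Σ_k h_{jk} c_k`**: on the annihilation operators `ad dΓ(h)` acts by
`-hᵀ`. Bratteli–Robinson II §5.2.1. [folklore] -/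
theorem dGamma_commutator_annihilation (h : Matrix ι ι ℂ) (j : ι) :
    dGamma h * annihilation j - annihilation j * dGamma h = ∑ k, (-hᵀ) k j • annihilation k := by
  simp only [dGamma, Finset.sum_mul, Finset.mul_sum, Matrix.smul_mul, Matrix.mul_smul,
    ← Finset.sum_sub_distrib, ← smul_sub, creation_mul_annihilation_commutator_annihilation,
    smul_ite, smul_zero, smul_neg, Matrix.neg_apply, Matrix.transpose_apply, neg_smul]
  rw [Finset.sum_comm]
  simp only [Finset.sum_ite_eq', Finset.mem_univ, if_true]

/-! ### Imaginary-time evolution of the fields under `dΓ(h)` -/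

/-- **Imaginary-time evolution of a creation operator under a quadratic Hamiltonian**:
`e^{s dΓ(h)} c†_j e^{-s dΓ(h)} = Σ_k (e^{s h})_{kj} c†_k` for every `s ∈ ℂ` (BGM's fields
`a⁺_𝐱 = e^{H₀x₀} a⁺_{x⃗} e^{-H₀x₀}` at `U = 0` evolve with the one-body matrix).
BGM 2006 §1.2, eq. (1.2) and §2.1; Bratteli–Robinson II §5.2.1.
[cite: BenfattoGiulianiMastropietro2006, §1.2] -/
theorem exp_dGamma_mul_creation_mul_exp_neg (h : Matrix ι ι ℂ) (s : ℂ) (j : ι) :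
    exp (s • dGamma h) * creation j * exp (-(s • dGamma h)) =
      ∑ k, (exp (s • h)) k j • creation k := by
  have hXY : ∀ l, s • dGamma h * creation l - creation l * (s • dGamma h) =
      ∑ k, (s • h) k l • creation k := fun l => by
    rw [Matrix.smul_mul, Matrix.mul_smul, ← smul_sub, dGamma_commutator_creation, Finset.smul_sum]
    simp only [Matrix.smul_apply, smul_eq_mul, smul_smul]
  open scoped Matrix.Norms.Operator in
  exact exp_mul_mul_exp_neg_eq_sum_of_commutator (s • dGamma h) creation (s • h) hXY j

/-- **Imaginary-time evolution of an annihilation operator under a quadratic Hamiltonian**: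
`e^{s dΓ(h)} c_j e^{-s dΓ(h)} = Σ_k (e^{-s h})_{jk} c_k` for every `s ∈ ℂ`.
BGM 2006 §1.2, eq. (1.2) and §2.1; Bratteli–Robinson II §5.2.1.
[cite: BenfattoGiulianiMastropietro2006, §1.2] -/
theorem exp_dGamma_mul_annihilation_mul_exp_neg (h : Matrix ι ι ℂ) (s : ℂ) (j : ι) :
    exp (s • dGamma h) * annihilation j * exp (-(s • dGamma h)) =
      ∑ k, (exp (-(s • h))) j k • annihilation k := by
  have hXY : ∀ l, s • dGamma h * annihilation l - annihilation l * (s • dGamma h) =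
      ∑ k, (-(s • h)ᵀ) k l • annihilation k := fun l => by
    rw [Matrix.smul_mul, Matrix.mul_smul, ← smul_sub, dGamma_commutator_annihilation,
      Finset.smul_sum]
    simp only [Matrix.neg_apply, Matrix.transpose_apply, Matrix.smul_apply, smul_eq_mul, smul_smul,
      mul_neg]
  have hsum : ∑ k, (exp (-(s • h))) j k • annihilation k =
      ∑ k, (exp (-(s • h)ᵀ)) k j • annihilation k := by
    refine Finset.sum_congr rfl fun k _ => ?_
    rw [← Matrix.transpose_neg, Matrix.exp_transpose, Matrix.transpose_apply]
  rw [hsum]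
  open scoped Matrix.Norms.Operator in
  exact exp_mul_mul_exp_neg_eq_sum_of_commutator (s • dGamma h) annihilation (-(s • h)ᵀ) hXY j

end Fock

/-! ### The Gibbs state of `dΓ(h)`: pull-through formula and the thermal two-point function -/

section TwoPoint

variable {ι : Type*} [LinearOrder ι] [Fintype ι]

/-- `e^{-β dΓ(h)} e^{β dΓ(h)} = 1`. [folklore] -/
theorem gibbsWeight_dGamma_mul_exp (β : ℝ) (h : Matrix ι ι ℂ) :
    gibbsWeight β (dGamma h) * exp ((β : ℂ) • dGamma h) = 1 := by
  rw [gibbsWeight, neg_smul,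
    ← Matrix.exp_add_of_commute (-((β : ℂ) • dGamma h)) ((β : ℂ) • dGamma h)
      (Commute.refl ((β : ℂ) • dGamma h)).neg_left, neg_add_cancel, exp_zero]

/-- **Pull-through formula.** `c†_i e^{-β dΓ(h)} = Σ_k (e^{βh})_{ki} e^{-β dΓ(h)} c†_k`: moving a
creation operator through the Gibbs weight of a quadratic Hamiltonian evolves it by `e^{βh}`
(Gaudin's starting point for the thermal Wick theorem). Gaudin, Nucl. Phys. 15 (1960) 89;
BGM 2006 §1.2. [cite: Gaudin1960] -/
theorem creation_mul_gibbsWeight_dGamma (β : ℝ) (h : Matrix ι ι ℂ) (i : ι) :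
    creation i * gibbsWeight β (dGamma h) =
      ∑ k, (exp ((β : ℂ) • h)) k i • (gibbsWeight β (dGamma h) * creation k) := by
  have key := exp_dGamma_mul_creation_mul_exp_neg h (β : ℂ) i
  have hW : gibbsWeight β (dGamma h) = exp (-((β : ℂ) • dGamma h)) := by
    rw [gibbsWeight, neg_smul]
  calc creation i * gibbsWeight β (dGamma h)
      = gibbsWeight β (dGamma h) * exp ((β : ℂ) • dGamma h) * creation i *
          exp (-((β : ℂ) • dGamma h)) := by
        rw [gibbsWeight_dGamma_mul_exp, Matrix.one_mul, ← hW]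
    _ = gibbsWeight β (dGamma h) *
          (exp ((β : ℂ) • dGamma h) * creation i * exp (-((β : ℂ) • dGamma h))) := by
        simp only [Matrix.mul_assoc]
    _ = ∑ k, (exp ((β : ℂ) • h)) k i • (gibbsWeight β (dGamma h) * creation k) := by
        rw [key, Finset.mul_sum]
        simp only [Matrix.mul_smul]

/-- **Pull-through formula for annihilation operators.**
`c_j e^{-β dΓ(h)} = Σ_k (e^{-βh})_{jk} e^{-β dΓ(h)} c_k`. Gaudin, Nucl. Phys. 15 (1960) 89.
[cite: Gaudin1960] -/
theorem annihilation_mul_gibbsWeight_dGamma (β : ℝ) (h : Matrix ι ι ℂ) (j : ι) :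
    annihilation j * gibbsWeight β (dGamma h) =
      ∑ k, (exp (-((β : ℂ) • h))) j k • (gibbsWeight β (dGamma h) * annihilation k) := by
  have key := exp_dGamma_mul_annihilation_mul_exp_neg h (β : ℂ) j
  have hW : gibbsWeight β (dGamma h) = exp (-((β : ℂ) • dGamma h)) := by
    rw [gibbsWeight, neg_smul]
  calc annihilation j * gibbsWeight β (dGamma h)
      = gibbsWeight β (dGamma h) * exp ((β : ℂ) • dGamma h) * annihilation j *
          exp (-((β : ℂ) • dGamma h)) := by
        rw [gibbsWeight_dGamma_mul_exp, Matrix.one_mul, ← hW]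
    _ = gibbsWeight β (dGamma h) *
          (exp ((β : ℂ) • dGamma h) * annihilation j * exp (-((β : ℂ) • dGamma h))) := by
        simp only [Matrix.mul_assoc]
    _ = ∑ k, (exp (-((β : ℂ) • h))) j k • (gibbsWeight β (dGamma h) * annihilation k) := by
        rw [key, Finset.mul_sum]
        simp only [Matrix.mul_smul]

/-- **Gaudin's identity for the two-point function.** With `W = e^{-β dΓ(h)}` and
`F_{ij} = tr (W c†_i c_j)`: `F_{ij} + Σ_k (e^{βh})_{ki} F_{kj} = δ_{ij} tr W` (CAR
`c†_i c_j = δ_{ij} - c_j c†_i`, cyclicity of the trace and the pull-through formula).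
Gaudin, Nucl. Phys. 15 (1960) 89. [cite: Gaudin1960] -/
theorem trace_gibbsWeight_dGamma_two_point_add (β : ℝ) (h : Matrix ι ι ℂ) (i j : ι) :
    (gibbsWeight β (dGamma h) * (creation i * annihilation j)).trace +
        ∑ k, (exp ((β : ℂ) • h)) k i *
          (gibbsWeight β (dGamma h) * (creation k * annihilation j)).trace =
      if i = j then partitionFn β (dGamma h) else 0 := by
  set W := gibbsWeight β (dGamma h) with hW
  have hcycl : (W * (annihilation j * creation i)).trace =
      ∑ k, (exp ((β : ℂ) • h)) k i * (W * (creation k * annihilation j)).trace := by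
    calc (W * (annihilation j * creation i)).trace = (creation i * W * annihilation j).trace := by
          rw [← Matrix.mul_assoc, Matrix.trace_mul_cycle]
      _ = ∑ k, (exp ((β : ℂ) • h)) k i * (W * (creation k * annihilation j)).trace := by
          rw [hW, creation_mul_gibbsWeight_dGamma, Finset.sum_mul, trace_sum]
          simp only [Matrix.smul_mul, trace_smul, smul_eq_mul, Matrix.mul_assoc]
  rw [eq_sub_of_add_eq' (annihilation_mul_creation_add_creation_mul_annihilation_holds j i),
    Matrix.mul_sub, trace_sub, hcycl, sub_add_cancel]
  by_cases hij : i = j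
  · subst hij
    simp [partitionFn, hW]
  · simp [hij, Ne.symm hij]

/-- The matrix `F_{ij} = tr (e^{-β dΓ(h)} c†_i c_j)` of un-normalised two-point traces.
Gaudin, Nucl. Phys. 15 (1960) 89. [folklore] -/
def twoPointTraceMatrix (β : ℝ) (h : Matrix ι ι ℂ) : Matrix ι ι ℂ :=
  Matrix.of fun i j => (gibbsWeight β (dGamma h) * (creation i * annihilation j)).trace

/-- `twoPointTraceMatrix` unfolded. [folklore] -/
theorem twoPointTraceMatrix_apply (β : ℝ) (h : Matrix ι ι ℂ) (i j : ι) :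
    twoPointTraceMatrix β h i j = (gibbsWeight β (dGamma h) * (creation i * annihilation j)).trace :=
  rfl

/-- **Gaudin's identity in matrix form**: `(1 + e^{βh})ᵀ F = (tr e^{-β dΓ(h)}) · 1`.
Gaudin, Nucl. Phys. 15 (1960) 89. [cite: Gaudin1960] -/
theorem transpose_one_add_exp_mul_twoPointTraceMatrix (β : ℝ) (h : Matrix ι ι ℂ) :
    (1 + exp ((β : ℂ) • h))ᵀ * twoPointTraceMatrix β h =
      partitionFn β (dGamma h) • (1 : Matrix ι ι ℂ) := by
  ext i j
  rw [Matrix.mul_apply, Matrix.smul_apply, Matrix.one_apply, smul_eq_mul, mul_ite, mul_one,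
    mul_zero, ← trace_gibbsWeight_dGamma_two_point_add β h i j]
  simp only [transpose_apply, Matrix.add_apply, Matrix.one_apply, add_mul, ite_mul, one_mul,
    zero_mul, Finset.sum_add_distrib, Finset.sum_ite_eq', Finset.mem_univ, if_true,
    twoPointTraceMatrix_apply]

/-- For Hermitian `h` and real `β`, `1 + e^{βh}` is positive definite, hence invertible.
[folklore] -/
theorem posDef_one_add_exp_smul {h : Matrix ι ι ℂ} (hh : h.IsHermitian) (β : ℝ) :
    (1 + exp ((β : ℂ) • h)).PosDef := by
  have hE : (exp ((β : ℂ) • h)).PosDef := by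
    have := posDef_gibbsWeight (-β) hh
    simpa [gibbsWeight] using this
  exact PosDef.one.add_posSemidef hE.posSemidef

/-- **The thermal two-point function of a quasi-free Gibbs state (ideal Fermi gas).** For a
Hermitian one-body matrix `h` and real `β`,
`⟨c†_i c_j⟩_β = tr (e^{-β dΓ(h)} c†_i c_j) / tr e^{-β dΓ(h)} = [(1 + e^{βh})⁻¹]_{ji}`,
the Fermi function of `h`. Bratteli–Robinson II §5.2.4 (the ideal Fermi gas: the Gibbs state
is the gauge-invariant quasi-free state with one-particle density `(1 + e^{βh})⁻¹`);
Gaudin, Nucl. Phys. 15 (1960) 89; for the free Hubbard model this is the equal-time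
value of BGM's free propagator, BGM 2006 eq. (1.4).
[cite: BratteliRobinsonII1997, §5.2.4] -/
theorem thermalCorr_dGamma_creation_annihilation {h : Matrix ι ι ℂ} (hh : h.IsHermitian)
    (β : ℝ) (i j : ι) :
    thermalCorr β (dGamma h) (creation i) (annihilation j) = (1 + exp ((β : ℂ) • h))⁻¹ j i := by
  haveI : Nonempty (Finset ι) := ⟨∅⟩
  set M : Matrix ι ι ℂ := 1 + exp ((β : ℂ) • h) with hM
  have hMdet : IsUnit Mᵀ.det := by
    rw [det_transpose]
    exact (posDef_one_add_exp_smul hh β).isUnit.map Matrix.detMonoidHom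
  have hZ : partitionFn β (dGamma h) ≠ 0 := (partitionFn_pos β (isHermitian_dGamma hh)).ne'
  have hF : twoPointTraceMatrix β h = partitionFn β (dGamma h) • Mᵀ⁻¹ := by
    calc twoPointTraceMatrix β h = Mᵀ⁻¹ * (Mᵀ * twoPointTraceMatrix β h) := by
          rw [← Matrix.mul_assoc, Matrix.nonsing_inv_mul _ hMdet, Matrix.one_mul]
      _ = partitionFn β (dGamma h) • Mᵀ⁻¹ := by
          rw [transpose_one_add_exp_mul_twoPointTraceMatrix, Matrix.mul_smul, Matrix.mul_one]
  have hFij : (gibbsWeight β (dGamma h) * (creation i * annihilation j)).trace =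
      partitionFn β (dGamma h) * M⁻¹ j i := by
    rw [← twoPointTraceMatrix_apply, hF, Matrix.smul_apply, smul_eq_mul, ← transpose_nonsing_inv,
      transpose_apply]
  rw [thermalCorr, gibbsState_apply, hFij, ← mul_assoc, inv_mul_cancel₀ hZ, one_mul]

/-- The complementary two-point function, `⟨c_j c†_i⟩_β = δ_{ij} - [(1 + e^{βh})⁻¹]_{ji}`
(CAR). Bratteli–Robinson II §5.2.4. [cite: BratteliRobinsonII1997, §5.2.4] -/
theorem thermalCorr_dGamma_annihilation_creation {h : Matrix ι ι ℂ} (hh : h.IsHermitian)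
    (β : ℝ) (i j : ι) :
    thermalCorr β (dGamma h) (annihilation j) (creation i) =
      (1 : Matrix ι ι ℂ) i j - (1 + exp ((β : ℂ) • h))⁻¹ j i := by
  haveI : Nonempty (Finset ι) := ⟨∅⟩
  have hZ : partitionFn β (dGamma h) ≠ 0 := (partitionFn_pos β (isHermitian_dGamma hh)).ne'
  have h1 : thermalCorr β (dGamma h) (annihilation j) (creation i) +
      thermalCorr β (dGamma h) (creation i) (annihilation j) = (1 : Matrix ι ι ℂ) i j := by
    rw [thermalCorr, thermalCorr, ← map_add,
      annihilation_mul_creation_add_creation_mul_annihilation_holds j i, Matrix.one_apply]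
    by_cases hij : i = j
    · subst hij; simp [gibbsState_one β _ hZ]
    · rw [if_neg (Ne.symm hij), if_neg hij, map_zero]
  rw [← h1, thermalCorr_dGamma_creation_annihilation hh, add_sub_cancel_right]

end TwoPoint

/-! ### The Hubbard model at `U = 0` is `dΓ` of its one-body matrix -/

section FreeHubbard

variable {Λ : Type*} [LinearOrder Λ] (G : SimpleGraph Λ) [DecidableRel G.Adj]

/-- The one-body matrix of the grand-canonical Hubbard model on the finite graph `G` with hopping
`t` and chemical potential `μ`, acting on the orbitals `Orb Λ = Λ ×ₗ Fin 2`: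
`h_{(x,σ),(y,σ')} = -t [x ∼ y] δ_{σσ'} - μ δ_{xy} δ_{σσ'}` (so that `H(t, 0) - μN = dΓ(h)`,
`hamiltonianWith_zero_eq_dGamma`). BGM 2006, eq. (1.1) at `U = 0` (there with hopping `½` and
`-Δ/2`, i.e. up to the constant `2 - μ_BGM` on the diagonal). [cite: BenfattoGiulianiMastropietro2006, eq. (1.1)] -/
def hubbardOneBody (t μ : ℝ) : Matrix (Orb Λ) (Orb Λ) ℂ :=
  Matrix.of fun o o' =>
    (if G.Adj (ofLex o).1 (ofLex o').1 ∧ (ofLex o).2 = (ofLex o').2 then -(t : ℂ) else 0) -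
      if o = o' then (μ : ℂ) else 0

/-- Entries of `hubbardOneBody`. [folklore] -/
theorem hubbardOneBody_apply (t μ : ℝ) (o o' : Orb Λ) :
    hubbardOneBody G t μ o o' =
      (if G.Adj (ofLex o).1 (ofLex o').1 ∧ (ofLex o).2 = (ofLex o').2 then -(t : ℂ) else 0) -
        if o = o' then (μ : ℂ) else 0 := rfl

/-- The Hubbard one-body matrix is Hermitian (real symmetric: `G.Adj` is symmetric). [folklore] -/
theorem isHermitian_hubbardOneBody (t μ : ℝ) : (hubbardOneBody G t μ).IsHermitian := by
  refine Matrix.IsHermitian.ext fun o o' => ?_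
  simp only [hubbardOneBody_apply, star_sub, apply_ite star, star_neg, Complex.star_def,
    Complex.conj_ofReal, star_zero, G.adj_comm, eq_comm]

variable [Fintype Λ]

/-- **The free Hubbard Hamiltonian is quadratic**: `H(t, 0) - μ N = dΓ(h)` for the one-body
matrix `h = hubbardOneBody G t μ`. BGM 2006 §2.1 (`H₀` = eq. (1.1) with `U = 0`).
[cite: BenfattoGiulianiMastropietro2006, §2.1] -/
theorem hamiltonianWith_zero_eq_dGamma (t μ : ℝ) :
    hamiltonianWith G t 0 μ = dGamma (hubbardOneBody G t μ) := by
  -- sums over `Orb Λ = Λ ×ₗ Fin 2` as iterated sums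
  have hre : ∀ f : Orb Λ → Matrix (Finset (Orb Λ)) (Finset (Orb Λ)) ℂ,
      ∑ o, f o = ∑ x : Λ, ∑ σ : Fin 2, f (orb x σ) := fun f => by
    rw [← Fintype.sum_prod_type', ← (toLex : Λ × Fin 2 ≃ Orb Λ).sum_comp]
  -- the spin sum against `δ_{σσ'}`
  have hσ : ∀ (P : Prop) [Decidable P] (σ : Fin 2)
      (T : Fin 2 → Matrix (Finset (Orb Λ)) (Finset (Orb Λ)) ℂ),
      (∑ σ', (if P ∧ σ = σ' then -(t : ℂ) else 0) • T σ') =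
        if P then -(t : ℂ) • T σ else 0 := by
    intro P _ σ T
    by_cases hP : P
    · simp only [hP, true_and, if_true, ite_smul, zero_smul, Finset.sum_ite_eq, Finset.mem_univ]
    · simp [hP]
  -- the chemical-potential part of `dΓ`
  have hμ : ∑ o : Orb Λ, ∑ o', (if o = o' then (μ : ℂ) else 0) • (creation o * annihilation o') =
      (μ : ℂ) • totalNumber := by
    simp only [ite_smul, zero_smul, Finset.sum_ite_eq, Finset.mem_univ, if_true,
      ← Finset.smul_sum]
    rw [← totalNumberOp_eq_totalNumber, totalNumberOp]
    rfl
  rw [hamiltonianWith, hamiltonian, dGamma]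
  simp only [hubbardOneBody_apply, sub_smul, Finset.sum_sub_distrib, hμ, Complex.ofReal_zero,
    zero_smul, add_zero]
  congr 1
  rw [hre]
  simp only [hre, ofLex_toLex, Finset.smul_sum, smul_ite, smul_zero]
  refine Finset.sum_congr rfl fun x _ => ?_
  rw [Finset.sum_comm]
  refine Finset.sum_congr rfl fun σ _ => Finset.sum_congr rfl fun y _ => ?_
  exact (hσ (G.Adj x y) σ fun σ' => creation (orb x σ) * annihilation (orb y σ')).symm

/-- The free grand-canonical Hubbard Hamiltonian is Hermitian. [folklore] -/
theorem isHermitian_hamiltonianWith_zero (t μ : ℝ) : (hamiltonianWith G t 0 μ).IsHermitian := by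
  rw [hamiltonianWith_zero_eq_dGamma]
  exact isHermitian_dGamma (isHermitian_hubbardOneBody G t μ)

/-- **The free Hubbard thermal two-point function is the Fermi matrix of the one-body
Hamiltonian**: `⟨c†_{xσ} c_{yσ'}⟩_{β, U=0} = [(1 + e^{βh})⁻¹]_{(y,σ'),(x,σ)}`,
`h = hubbardOneBody G t μ` — the equal-time value of BGM's free propagator (1.4) in any finite
volume (on the torus, diagonalising `h` by plane waves gives the momentum sum of (1.4)).
BGM 2006 §1.2, eq. (1.4); Bratteli–Robinson II §5.2.4. [cite: BenfattoGiulianiMastropietro2006, eq. (1.4)] -/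
theorem thermalCorr_hamiltonianWith_zero (β t μ : ℝ) (x y : Λ) (σ σ' : Fin 2) :
    thermalCorr β (hamiltonianWith G t 0 μ) (creation (orb x σ)) (annihilation (orb y σ')) =
      (1 + exp ((β : ℂ) • hubbardOneBody G t μ))⁻¹ (orb y σ') (orb x σ) := by
  rw [hamiltonianWith_zero_eq_dGamma]
  exact thermalCorr_dGamma_creation_annihilation (isHermitian_hubbardOneBody G t μ) β _ _

end FreeHubbard




end Literature.MathematicalPhysics.QuantumLattice
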